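import Literature.Analysis.FluidPDE.PassiveScalarDriftApproxL2
import Literature.Analysis.FluidPDE.PassiveScalarLimitL2Drift
import Literature.Analysis.FluidPDE.LerayHopfTranslateTorusTools
import Literature.Analysis.FluidPDE.LerayHopf
import HarnessLib

/-!
# Existence of weak passive scalars for `L^∞_t L²_x` drifts, and of releases into a
# Leray–Hopf drift

Analysis/FluidPDE proof-support file (everything proved).

* `exists_isWeakScalarTransportOn_of_sq` — for `κ > 0`, `T > 0`, a datum `θ₀ ∈ L²(T^d)` and a
  space–time measurable drift `u` with `∫ ‖u(t)‖² ≤ M` for a.e. `t ∈ (0,T)` (the class of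
  Leray–Hopf velocity fields), weakly divergence free at a.e. time, there is a weak solution of
  `∂ₜθ + u·∇θ = κΔθ` on `T^d × [0,T)` with datum `θ₀` (`Torus.IsWeakScalarTransportOn`), and
  `∫ |θ(t)|² ≤ ‖θ₀‖²_{L²}` for a.e. `t`: DiPerna–Lions 1989, Prop. II.1, by the regularisation
  scheme of its proof in the parabolic setting — regularised drifts (`PassiveScalarDriftApproxL2`)
  and data, classical solutions of the regularised problems
  (`exists_unique_isClassicalScalarTransportForcedOn_holds`), the drift-independent bound
  `‖θₙ(t)‖₂ ≤ ‖θ₀‖₂` from the classical energy identity, weak-* compactness in `L^∞(0,T;L²)`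
  (`exists_strictMono_weakLimit_of_lintegral_sq_le`) and the identification
  `IsWeakScalarTransportOn.of_tendsto_of_lintegral_sq_le` (`PassiveScalarLimitL2Drift`). This
  removes the boundedness hypothesis on the drift of `exists_isWeakScalarTransportOn_of_pos`
  (`PassiveScalarExistenceProofs`).
* `IsGlobalLerayHopf.exists_release`, `IsGlobalLerayHopf.exists_release_family` — a RELEASE of a
  profile `h ∈ L²(T^d)` at time `s ≥ 0` into a velocity field `v` is a weak solution `ϑ` of
  `∂_τ ϑ + v(s+τ)·∇ϑ = κΔϑ`, `ϑ(0) = h` (`IsWeakScalarTransportOn T κ (fun τ => v (s + τ)) h ϑ`).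
  For a global Leray–Hopf velocity field on the flat torus (any dimension, any force) and
  `κ > 0`, releases exist at every `s ≥ 0` for every horizon `T > 0`, with
  `∫ |ϑ(τ)|² ≤ ‖h‖²_{L²}` for a.e. `τ` (the translated drift is space–time measurable, in
  `L^∞_t L²_x` by the Leray–Hopf energy bound on `(0, s+T)`, and weakly divergence free at a.e.
  time); countable families (e.g. at grid times `δ(n+1)`) follow by choice.

This is the "existence of the releases" input of the age-decoupling argument for steadily
sourced scalars (`FluidPDE/AgeDecouplingInequality`).

## References

* R. J. DiPerna, P.-L. Lions, Invent. Math. 98 (1989), 511–547, Prop. II.1. [`DiPernaLions1989`]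
* L. C. Evans, *Partial Differential Equations*, 2nd ed. (2010), §7.1.2, Thm. 2–3. [`Evans2010`]
* E. Hopf, Math. Nachr. 4 (1951), 213–231 (the Leray–Hopf class). [`Hopf1951`]
-/

noncomputable section

open _root_.MeasureTheory _root_.TopologicalSpace _root_.Set _root_.Function _root_.Filter _root_.Metric
open _root_.Topology
open scoped ENNReal NNReal Convolution InnerProductSpace ContDiff

namespace Literature.Analysis.FluidPDE

namespace Torus

variable {d : Type*} [Fintype d]


/-! ## Existence for `L^∞_t L²_x` drifts -/

section Existence

variable [DecidableEq d]

/-- **Existence of weak solutions of the passive scalar equation for an `L^∞_t L²_x` drift**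
(DiPerna–Lions 1989, Prop. II.1, by the regularisation scheme of its proof in the parabolic
setting; the velocity class is that of Leray–Hopf fields): for `κ > 0`, `T > 0`, a datum
`θ₀ ∈ L²(T^d)` and a space–time measurable drift `u` with `∫ ‖u(t)‖² ≤ M` for a.e. `t ∈ (0,T)`,
weakly divergence free at a.e. time, there is a weak solution `θ` of `∂ₜθ + u·∇θ = κΔθ` on
`T^d × [0,T)` with datum `θ₀`, and `∫ |θ(t)|² ≤ ‖θ₀‖²_{L²}` for a.e. `t ∈ (0,T)` (regularised
drifts `exists_smooth_isDivFree_tendsto_eLpNorm_sub_of_sq` and data, classical solutions of the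
regularised problems by `exists_unique_isClassicalScalarTransportForcedOn_holds`, the
drift-independent bound `‖θₙ(t)‖₂ ≤ ‖θ₀‖₂` from the classical energy identity, weak-* compactness
in `L^∞(0,T;L²)` and the identification `IsWeakScalarTransportOn.of_tendsto_of_lintegral_sq_le`).
[cite: DiPernaLions1989, Prop. II.1] -/
theorem exists_isWeakScalarTransportOn_of_sq {T κ : ℝ} (hκ : 0 < κ) (hT : 0 < T)
    {u : ℝ → UnitAddTorus d → EuclideanSpace ℝ d} {θ₀ : UnitAddTorus d → ℝ} (hθ₀ : MemLp θ₀ 2 volume)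
    (hum : AEStronglyMeasurable (FunctionSpaces.Torus.stLift u) (volume.restrict (Ioo 0 T ×ˢ univ)))
    {M : ℝ≥0} (hub : ∀ᵐ t ∂(volume.restrict (Ioo 0 T)), ∫⁻ x, ‖u t x‖ₑ ^ 2 ≤ M)
    (hdiv : ∀ᵐ t ∂(volume.restrict (Ioo 0 T)), FunctionSpaces.Torus.IsWeaklyDivFree (u t)) :
    ∃ θ : ℝ → UnitAddTorus d → ℝ, IsWeakScalarTransportOn T κ u θ₀ θ ∧
      ∀ᵐ t ∂(volume.restrict (Ioo 0 T)), ∫⁻ x, ‖θ t x‖ₑ ^ 2 ≤ eLpNorm θ₀ 2 volume ^ 2 := by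
  -- the drift is square integrable on `(0,T) × T^d`
  have hu2 : ∫⁻ t in Ioo 0 T, ∫⁻ x, ‖u t x‖ₑ ^ 2 < ⊤ :=
    calc ∫⁻ t in Ioo 0 T, ∫⁻ x, ‖u t x‖ₑ ^ 2 ≤ ∫⁻ _ in Ioo 0 T, (M : ℝ≥0∞) := lintegral_mono_ae hub
      _ < ⊤ := by
          rw [lintegral_const, Measure.restrict_apply_univ]
          exact ENNReal.mul_lt_top ENNReal.coe_lt_top measure_Ioo_lt_top
  -- regularised data
  obtain ⟨v, hvs, hvdiv, hvlim⟩ := exists_smooth_isDivFree_tendsto_eLpNorm_sub_of_sq hum hu2 hdiv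
  obtain ⟨g, hgs, hgle, hglim⟩ := exists_isSmooth_tendsto_eLpNorm_sub hθ₀
  -- classical solutions of the regularised problems
  have hcl : ∀ n, ∃ θ : ℝ → UnitAddTorus d → ℝ,
      IsClassicalScalarTransportOn (Icc 0 T) κ (v n) θ ∧ θ 0 = g n := by
    intro n
    obtain ⟨θ, hθ, h0, -⟩ := exists_unique_isClassicalScalarTransportOn_of_forced
      exists_unique_isClassicalScalarTransportForcedOn_holds hκ hT
      (FunctionSpaces.Torus.isSmoothSpaceTimeOn_of_contDiff (hvs n) _) (fun t _ => hvdiv n t) (hgs n)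
    exact ⟨θ, hθ, h0⟩
  choose θ hθ hθ0 using hcl
  have hsol : ∀ n, IsWeakScalarTransportOn T κ (v n) (g n) (θ n) := by
    intro n
    have h := IsClassicalScalarTransportOn.isWeakScalarTransportOn_holds (hθ n) subset_rfl
    rwa [hθ0 n] at h
  -- the a priori bound `∫ |θₙ(t)|² ≤ ‖θ₀‖₂²` for `t ∈ [0, T]`
  set C : ℝ≥0 := (eLpNorm θ₀ 2 volume ^ 2).toNNReal with hC
  have hCeq : (C : ℝ≥0∞) = eLpNorm θ₀ 2 volume ^ 2 :=
    ENNReal.coe_toNNReal (ENNReal.pow_ne_top hθ₀.eLpNorm_ne_top)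
  have hbd' : ∀ n, ∀ t ∈ Icc 0 T, ∫⁻ x, ‖θ n t x‖ₑ ^ 2 ≤ C := by
    intro n t ht
    have hθc : Continuous (θ n t) := ((hθ n).smooth_scalar.isSmooth_slice ht).continuous
    have hgc : Continuous (g n) := (hgs n).continuous
    have hE := IsClassicalScalarTransportOn.scalarL2Sq_add_scalarDissipation_holds (hθ n) ht.1
      (Icc_subset_Icc_right ht.2)
    have hD := scalarDissipation_nonneg hκ.le (θ n) ht.1
    have hle : scalarL2Sq (θ n t) ≤ scalarL2Sq (g n) := by rw [← hθ0 n]; linarith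
    calc ∫⁻ x, ‖θ n t x‖ₑ ^ 2 = ENNReal.ofReal (scalarL2Sq (θ n t)) := lintegral_enorm_sq_eq_ofReal_integral_sq hθc
      _ ≤ ENNReal.ofReal (scalarL2Sq (g n)) := ENNReal.ofReal_le_ofReal hle
      _ = eLpNorm (g n) 2 volume ^ 2 := by
          rw [scalarL2Sq, ← lintegral_enorm_sq_eq_ofReal_integral_sq hgc, FunctionSpaces.eLpNorm_two_pow_two_eq_lintegral]
      _ ≤ eLpNorm θ₀ 2 volume ^ 2 := by gcongr; exact hgle n
      _ = C := hCeq.symm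
  have hbd : ∀ n, ∀ᵐ t ∂(volume.restrict (Ioo 0 T)), ∫⁻ x, ‖θ n t x‖ₑ ^ 2 ≤ C := fun n =>
    (ae_restrict_mem measurableSet_Ioo).mono fun t ht => hbd' n t (Ioo_subset_Icc_self ht)
  -- weak-* compactness and identification of the limit
  obtain ⟨φ, hφ, W, hWm, hWb, hWlim⟩ :=
    FunctionSpaces.Torus.exists_strictMono_weakLimit_of_lintegral_sq_le (fun n => (hsol n).aestronglyMeasurable) hbd
  refine ⟨W, IsWeakScalarTransportOn.of_tendsto_of_lintegral_sq_le (fun j => hsol (φ j)) (fun j => hbd (φ j)) hWm hWb hWlim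
    hum hub hdiv (hvlim.comp hφ.tendsto_atTop) hθ₀ (fun j => (hgs (φ j)).memLp 2) (hglim.comp hφ.tendsto_atTop), ?_⟩
  filter_upwards [hWb] with t ht
  rwa [hCeq] at ht

end Existence

/-! ## Releases into a Leray–Hopf drift -/

section Release

variable [DecidableEq d]

/-- **Releases of an `L²` profile into a global Leray–Hopf drift exist.** For a global
Leray–Hopf velocity field `v` on `T^d`, `κ > 0`, `T > 0`, `s ≥ 0` and `h ∈ L²(T^d)` there is a
weak solution `ϑ` of `∂_τϑ + v(s+τ)·∇ϑ = κΔϑ` on `T^d × [0,T)` with datum `h`, and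
`∫ |ϑ(τ)|² ≤ ‖h‖²_{L²}` for a.e. `τ ∈ (0,T)`. [cite: DiPernaLions1989, Prop. II.1] -/
theorem IsGlobalLerayHopf.exists_release {ν : ℝ} {f : ℝ → UnitAddTorus d → EuclideanSpace ℝ d}
    {v₀ : UnitAddTorus d → EuclideanSpace ℝ d} {v : ℝ → UnitAddTorus d → EuclideanSpace ℝ d}
    (hv : IsGlobalLerayHopf ν f v₀ v) {κ T s : ℝ} (hκ : 0 < κ) (hT : 0 < T) (hs : 0 ≤ s)
    {h : UnitAddTorus d → ℝ} (hh : MemLp h 2 volume) :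
    ∃ ϑ : ℝ → UnitAddTorus d → ℝ, IsWeakScalarTransportOn T κ (fun τ => v (s + τ)) h ϑ ∧
      ∀ᵐ τ ∂(volume.restrict (Ioo 0 T)), ∫⁻ x, ‖ϑ τ x‖ₑ ^ 2 ≤ eLpNorm h 2 volume ^ 2 := by
  -- the Leray–Hopf structure on the horizon `T + s`
  have hTs : 0 < T + s := by linarith
  have hLH := hv (T + s) hTs
  -- the translated drift, written with `τ + s`
  have hfun : (fun τ => v (s + τ)) = fun τ => v (τ + s) := by
    funext τ; rw [add_comm]
  rw [hfun]
  -- measurability of the translate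
  have hum : AEStronglyMeasurable (FunctionSpaces.Torus.stLift fun τ => v (τ + s))
      (volume.restrict (Ioo 0 T ×ˢ univ)) :=
    aestronglyMeasurable_stLift_translate hs le_rfl hLH.weak.1
  -- the `L^∞_t L²_x` bound, translated
  obtain ⟨M, hM⟩ := hLH.energy_bound
  have hub : ∀ᵐ τ ∂(volume.restrict (Ioo 0 T)), ∫⁻ x, ‖v (τ + s) x‖ₑ ^ 2 ≤ M := by
    refine ae_restrict_Ioo_comp_add_right s (P := fun t => ∫⁻ x, ‖v t x‖ₑ ^ 2 ≤ M) ?_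
    rw [zero_add]
    exact ae_restrict_of_ae_restrict_of_subset (Ioo_subset_Ioo hs le_rfl) hM
  -- weak incompressibility, translated
  have hdiv : ∀ᵐ τ ∂(volume.restrict (Ioo 0 T)), FunctionSpaces.Torus.IsWeaklyDivFree (v (τ + s)) := by
    refine ae_restrict_Ioo_comp_add_right s (P := fun t => FunctionSpaces.Torus.IsWeaklyDivFree (v t)) ?_
    rw [zero_add]
    exact ae_restrict_of_ae_restrict_of_subset (Ioo_subset_Ioo hs le_rfl) hLH.weak.ae_isWeaklyDivFree
  exact exists_isWeakScalarTransportOn_of_sq hκ hT hh hum hub hdiv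

/-- **Countable families of releases** (choice): for a global Leray–Hopf drift, `κ > 0`, a
horizon `T > 0`, an `L²` profile `h` and any sequence of release times `σ n ≥ 0` there is a
family `ϑ n` of releases of `h` at the times `σ n`, each with `∫ |ϑ n (τ)|² ≤ ‖h‖²_{L²}` for a.e.
`τ ∈ (0,T)`. [cite: DiPernaLions1989, Prop. II.1] -/
theorem IsGlobalLerayHopf.exists_release_family {ν : ℝ} {f : ℝ → UnitAddTorus d → EuclideanSpace ℝ d}
    {v₀ : UnitAddTorus d → EuclideanSpace ℝ d} {v : ℝ → UnitAddTorus d → EuclideanSpace ℝ d}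
    (hv : IsGlobalLerayHopf ν f v₀ v) {κ T : ℝ} (hκ : 0 < κ) (hT : 0 < T) {σ : ℕ → ℝ}
    (hσ : ∀ n, 0 ≤ σ n) {h : UnitAddTorus d → ℝ} (hh : MemLp h 2 volume) :
    ∃ ϑ : ℕ → ℝ → UnitAddTorus d → ℝ, ∀ n,
      IsWeakScalarTransportOn T κ (fun τ => v (σ n + τ)) h (ϑ n) ∧
        ∀ᵐ τ ∂(volume.restrict (Ioo 0 T)), ∫⁻ x, ‖ϑ n τ x‖ₑ ^ 2 ≤ eLpNorm h 2 volume ^ 2 := by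
  choose ϑ hϑ using fun n => hv.exists_release hκ hT (hσ n) hh
  exact ⟨ϑ, hϑ⟩

end Release

end Torus

end Literature.Analysis.FluidPDE

end
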